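import Summits.QuantumFields.BalabanUV.Beta.D1BFx.MixedVarPackedHess
import Summits.QuantumFields.BalabanUV.Beta.D1BFx.BorderedInverseMassive

/-!
# `BalabanUV.Beta.D1BFx.GhostSplitJetsProd` — road «BF-x» for binder row D1, slot (K), model brick **«K-TB3a-PROD»: THE BORDERED FUNCTIONAL OF
# A PRODUCT** (ruling ρ-g7-5, FINDING F-g7-2).  Pure finite matrix algebra (trace cyclicity + the explicit KKT inverse), any finite index types, constant
# border `Q`:
#  §1 **`hessT_mul_jets`** — `hessT ((A₀B₀)⁻¹; (AB)•) = hessT (A₀⁻¹; A•) + hessT (B₀⁻¹; B•)` for the product-rule jets `(AB)ₛ = AₛB₀ + A₀Bₛ`,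
#     `(AB)ₛₜ = AₛₜB₀ + AₛBₜ + AₜBₛ + A₀Bₛₜ` (the jet form of `log det (AB) = log det A + log det B`);
#  §2 **`hessT_kkt_const_border`** — for invertible `Y₀` and `S₀ := Q·Y₀⁻¹·Qᵀ` invertible: `hessT ((kkt Y₀ Q)⁻¹; kkt Y• 0) = hessT (Y₀⁻¹; Y•) +
#     hessT (S₀⁻¹; S•)` with the coarse-Gram jets `Sₛ = −QY₀⁻¹YₛY₀⁻¹Qᵀ`, `Sₛₜ = −QY₀⁻¹YₛₜY₀⁻¹Qᵀ + QY₀⁻¹YₛY₀⁻¹YₜY₀⁻¹Qᵀ + QY₀⁻¹YₜY₀⁻¹YₛY₀⁻¹Qᵀ`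
#     (the jet form of the Schur factorisation `det kkt (Y, Q) = ± det Y · det (QY⁻¹Qᵀ)`; NO symmetry of `Y` is used) — via this lineage's
#     `BorderedInverseMassive.kkt_inv_eq_massiveBlocks` at `a′ = 0`;
#  §3 **`hessT_kkt_prod_jets`** — §2 at `Y = A·B` plus §1: `hessT ((kkt (A₀B₀) Q)⁻¹; kkt (AB)• 0) = hessT (A₀⁻¹; A•) + hessT (B₀⁻¹; B•) + hessT (S̃₀⁻¹; S̃•)`,
#     `S̃ = Q·B⁻¹A⁻¹·Qᵀ`.  This is the two-factor twin of ne9-leaf-02-g25's K-TB3a `GhostSplitJets.hessT_kkt_sq_jets` (`M·M`), and the one step of F-g7-2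
#     («the X-word is a HALF-COVARIANT tower word: `Y_X = L̂_U·D̂_U*·D̂ ≃ (L_U + cS)·(D_U*D̂ + cS)`») that was not yet a tree lemma

HONEST FRAMING (cell contract, verbatim): «discharging `BetaPertH` makes Bałaban's UV stability UNCONDITIONAL — a real constructive-QFT
result; it is NOT the continuum limit and NOT the Clay problem.»  HONEST DEPENDENCY (verbatim): «continuum YM on T⁴ ⇐ BetaPertH ∧ nine
spine estimates (0/9 proved); BetaPertH ⇐ (D1) ∧ (D4) ∧ CAP+tail; G-an2-4 gates asym, D1 and NE2/3/4.»  THIS MODULE DISCHARGES NOTHING of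
D1 / BetaPertH: [folklore] finite matrix algebra; no `def`, no `def … : Prop`, nothing cited, 0 sorry.  A MODEL brick (all types arbitrary finite);
the road instance (legs `(Ggh)^`, `(Csq)^`; words of `D_U*·D̂`) is TB5-2c-D.  NOT summit progress; NOT BetaPertH, NOT continuum, NOT Clay.

ABSOLUTE RULE (cell, verbatim): «No internally-minted statement may enter as a cited fact. Every hypothesis is either kernel-proved in this
package or a verbatim quotation of a PUBLISHED theorem with page reference. The manuscript(s) under audit are NOT citable for their own
disputed steps — they are the thing under adjudication; programme-internal (2001/route/tribunal) claims are never citable.»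

Unit `b2b-balaban-beta-d1-p2` (road owner, gen 7).  Exact-ℚ cross-check of §1–§3 on a 6×6 torus: `HOME/b2b-balaban-beta-d1-p2/num/check_fg72_exact.py`.
-/

noncomputable section

namespace Summit.QuantumFields.BalabanUV.Beta.D1BFx.GhostSplitJetsProd

open Matrix
open scoped BigOperators
open Literature.MathematicalPhysics.QuantumFieldTheory.Balaban1983to89.Beta.Composition (kkt)
open Summit.QuantumFields.BalabanUV.Beta.D1BFx.MixedVarPackedHess (hessT trace_fromBlocks_mul_fromBlocks)
open Summit.QuantumFields.BalabanUV.Beta.D1BFx.BorderedInverseMassive (massiveBlocks kkt_inv_eq_massiveBlocks)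

/-! ## §1 The functional of a product splits -/

section Product

variable {ι : Type*} [Fintype ι] [DecidableEq ι]

/-- [folklore] **`log det (AB)` AT THE JET LEVEL**: for `A₀`, `B₀` with `det ≠ 0` and ANY jets,
`hessT ((A₀B₀)⁻¹; AₛB₀ + A₀Bₛ, AₜB₀ + A₀Bₜ, AₛₜB₀ + AₛBₜ + AₜBₛ + A₀Bₛₜ) = hessT (A₀⁻¹; Aₛ, Aₜ, Aₛₜ) + hessT (B₀⁻¹; Bₛ, Bₜ, Bₛₜ)`. -/
theorem hessT_mul_jets (A₀ Aₛ Aₜ Aₛₜ B₀ Bₛ Bₜ Bₛₜ : Matrix ι ι ℝ) (hA : IsUnit A₀.det) (hB : IsUnit B₀.det) :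
    hessT (A₀ * B₀)⁻¹ (Aₛ * B₀ + A₀ * Bₛ) (Aₜ * B₀ + A₀ * Bₜ) (Aₛₜ * B₀ + Aₛ * Bₜ + Aₜ * Bₛ + A₀ * Bₛₜ)
      = hessT A₀⁻¹ Aₛ Aₜ Aₛₜ + hessT B₀⁻¹ Bₛ Bₜ Bₛₜ := by
  have hAi : A₀⁻¹ * A₀ = 1 := Matrix.nonsing_inv_mul _ hA
  have hBi : B₀⁻¹ * B₀ = 1 := Matrix.nonsing_inv_mul _ hB
  have hBi' : B₀ * B₀⁻¹ = 1 := Matrix.mul_nonsing_inv _ hB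
  have hinv : (A₀ * B₀)⁻¹ = B₀⁻¹ * A₀⁻¹ := Matrix.mul_inv_rev A₀ B₀
  -- reduction rules: `(A₀B₀)⁻¹·(X·B₀ + A₀·Z) = B₀⁻¹(A₀⁻¹X)B₀ + B₀⁻¹Z`
  have red : ∀ X Z : Matrix ι ι ℝ, (A₀ * B₀)⁻¹ * (X * B₀ + A₀ * Z) = B₀⁻¹ * (A₀⁻¹ * X) * B₀ + B₀⁻¹ * Z := by
    intro X Z
    rw [hinv, Matrix.mul_add]
    congr 1
    · simp only [Matrix.mul_assoc]
    · rw [show B₀⁻¹ * A₀⁻¹ * (A₀ * Z) = B₀⁻¹ * (A₀⁻¹ * A₀) * Z by simp only [Matrix.mul_assoc], hAi, Matrix.mul_one]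
  have red2 : (A₀ * B₀)⁻¹ * (Aₛₜ * B₀ + Aₛ * Bₜ + Aₜ * Bₛ + A₀ * Bₛₜ)
      = B₀⁻¹ * (A₀⁻¹ * Aₛₜ) * B₀ + B₀⁻¹ * (A₀⁻¹ * Aₛ) * Bₜ + B₀⁻¹ * (A₀⁻¹ * Aₜ) * Bₛ + B₀⁻¹ * Bₛₜ := by
    rw [hinv, Matrix.mul_add, Matrix.mul_add, Matrix.mul_add]
    have e4 : B₀⁻¹ * A₀⁻¹ * (A₀ * Bₛₜ) = B₀⁻¹ * Bₛₜ := by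
      rw [show B₀⁻¹ * A₀⁻¹ * (A₀ * Bₛₜ) = B₀⁻¹ * (A₀⁻¹ * A₀) * Bₛₜ by simp only [Matrix.mul_assoc], hAi, Matrix.mul_one]
    rw [e4]
    simp only [Matrix.mul_assoc]
  unfold hessT
  rw [red, red, red2]
  -- traces: conjugation by `B₀` disappears (`tr (B₀⁻¹ M B₀) = tr M`)
  have conj : ∀ M : Matrix ι ι ℝ, (B₀⁻¹ * M * B₀).trace = M.trace := by
    intro M
    rw [Matrix.mul_assoc, Matrix.trace_mul_comm, Matrix.mul_assoc, hBi', Matrix.mul_one]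
  -- expand the bubble
  set a := A₀⁻¹ * Aₛ with ha
  set a' := A₀⁻¹ * Aₜ with ha'
  set b := B₀⁻¹ * Bₛ with hb
  set b' := B₀⁻¹ * Bₜ with hb'
  have hbub : ((B₀⁻¹ * a * B₀ + b) * (B₀⁻¹ * a' * B₀ + b')).trace
      = (a * a').trace + (a * (Bₜ * B₀⁻¹)).trace + (a' * (Bₛ * B₀⁻¹)).trace + (b * b').trace := by
    rw [Matrix.add_mul, Matrix.mul_add, Matrix.mul_add, Matrix.trace_add, Matrix.trace_add, Matrix.trace_add]
    have t1 : (B₀⁻¹ * a * B₀ * (B₀⁻¹ * a' * B₀)).trace = (a * a').trace := by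
      rw [show B₀⁻¹ * a * B₀ * (B₀⁻¹ * a' * B₀) = B₀⁻¹ * (a * (B₀ * B₀⁻¹) * a') * B₀ by simp only [Matrix.mul_assoc], hBi',
        Matrix.mul_one, conj]
    have t2 : (B₀⁻¹ * a * B₀ * b').trace = (a * (Bₜ * B₀⁻¹)).trace := by
      rw [hb', show B₀⁻¹ * a * B₀ * (B₀⁻¹ * Bₜ) = B₀⁻¹ * (a * (B₀ * B₀⁻¹) * Bₜ) by simp only [Matrix.mul_assoc], hBi', Matrix.mul_one,
        Matrix.trace_mul_comm, Matrix.mul_assoc]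
    have t3 : (b * (B₀⁻¹ * a' * B₀)).trace = (a' * (Bₛ * B₀⁻¹)).trace := by
      rw [hb, show B₀⁻¹ * Bₛ * (B₀⁻¹ * a' * B₀) = (B₀⁻¹ * Bₛ * B₀⁻¹ * a') * B₀ by simp only [Matrix.mul_assoc], Matrix.trace_mul_comm,
        show B₀ * (B₀⁻¹ * Bₛ * B₀⁻¹ * a') = (B₀ * B₀⁻¹) * (Bₛ * B₀⁻¹ * a') by simp only [Matrix.mul_assoc], hBi', Matrix.one_mul,
        Matrix.trace_mul_comm]
    rw [t1, t2, t3]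
    ring
  -- expand the tadpole
  have htad : (B₀⁻¹ * (A₀⁻¹ * Aₛₜ) * B₀ + B₀⁻¹ * a * Bₜ + B₀⁻¹ * a' * Bₛ + B₀⁻¹ * Bₛₜ).trace
      = (A₀⁻¹ * Aₛₜ).trace + (a * (Bₜ * B₀⁻¹)).trace + (a' * (Bₛ * B₀⁻¹)).trace + (B₀⁻¹ * Bₛₜ).trace := by
    rw [Matrix.trace_add, Matrix.trace_add, Matrix.trace_add, conj]
    have u2 : (B₀⁻¹ * a * Bₜ).trace = (a * (Bₜ * B₀⁻¹)).trace := by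
      rw [Matrix.mul_assoc, Matrix.trace_mul_comm, Matrix.mul_assoc]
    have u3 : (B₀⁻¹ * a' * Bₛ).trace = (a' * (Bₛ * B₀⁻¹)).trace := by
      rw [Matrix.mul_assoc, Matrix.trace_mul_comm, Matrix.mul_assoc]
    rw [u2, u3]
  rw [htad, hbub, ha, ha', hb, hb']
  ring

end Product

/-! ## §2 The bordered functional with a constant border splits into bulk + coarse Gram -/

section Border

variable {ν μ : Type*} [Fintype ν] [Fintype μ] [DecidableEq ν] [DecidableEq μ]

/-- [folklore] The KKT inverse at `a′ = 0`: `(kkt Y Q)⁻¹ = [[G − GQᵀCQG, GQᵀC],[CQG, −C]]`, `G = Y⁻¹`, `C = (QGQᵀ)⁻¹`. -/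
theorem kkt_inv_eq_blocks (Y : Matrix ν ν ℝ) (Q : Matrix μ ν ℝ) (hY : IsUnit Y.det) (hS : IsUnit (Q * Y⁻¹ * Qᵀ).det) :
    (kkt Y Q)⁻¹ = Matrix.fromBlocks (Y⁻¹ - Y⁻¹ * Qᵀ * (Q * Y⁻¹ * Qᵀ)⁻¹ * Q * Y⁻¹) (Y⁻¹ * Qᵀ * (Q * Y⁻¹ * Qᵀ)⁻¹)
        ((Q * Y⁻¹ * Qᵀ)⁻¹ * Q * Y⁻¹) (-(Q * Y⁻¹ * Qᵀ)⁻¹) := by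
  have h := kkt_inv_eq_massiveBlocks Y Y⁻¹ Q (Q * Y⁻¹ * Qᵀ)⁻¹ 0 (by rw [zero_smul, add_zero, Matrix.mul_nonsing_inv _ hY])
    (Matrix.mul_nonsing_inv _ hS)
  rw [h, massiveBlocks, zero_smul, zero_sub]

omit [DecidableEq ν] in
/-- [folklore] Traces against jets living in the `(ν,ν)` block only see the `(ν,ν)` block of the leg. -/
theorem trace_fromBlocks_mul_kkt_zero (Γ : Matrix ν ν ℝ) (H : Matrix ν μ ℝ) (H' : Matrix μ ν ℝ) (C : Matrix μ μ ℝ) (Y : Matrix ν ν ℝ) :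
    (Matrix.fromBlocks Γ H H' C * kkt Y (0 : Matrix μ ν ℝ)).trace = (Γ * Y).trace := by
  rw [kkt, Matrix.transpose_zero, trace_fromBlocks_mul_fromBlocks]
  simp

omit [DecidableEq ν] in
/-- [folklore] The bubble against two `(ν,ν)`-block jets. -/
theorem trace_bubble_fromBlocks_kkt_zero (Γ : Matrix ν ν ℝ) (H : Matrix ν μ ℝ) (H' : Matrix μ ν ℝ) (C : Matrix μ μ ℝ) (Y Y' : Matrix ν ν ℝ) :
    (Matrix.fromBlocks Γ H H' C * kkt Y (0 : Matrix μ ν ℝ) * (Matrix.fromBlocks Γ H H' C * kkt Y' (0 : Matrix μ ν ℝ))).trace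
      = (Γ * Y * (Γ * Y')).trace := by
  have e : Matrix.fromBlocks Γ H H' C * kkt Y (0 : Matrix μ ν ℝ) = Matrix.fromBlocks (Γ * Y) 0 (H' * Y) 0 := by
    rw [kkt, Matrix.transpose_zero, Matrix.fromBlocks_multiply]
    simp
  have e' : Matrix.fromBlocks Γ H H' C * kkt Y' (0 : Matrix μ ν ℝ) = Matrix.fromBlocks (Γ * Y') 0 (H' * Y') 0 := by
    rw [kkt, Matrix.transpose_zero, Matrix.fromBlocks_multiply]
    simp
  rw [e, e', trace_fromBlocks_mul_fromBlocks]
  simp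

omit [DecidableEq ν] in
/-- [folklore] `hessT` of a block leg against `(ν,ν)`-block jets is `hessT` of the `(ν,ν)` block. -/
theorem hessT_fromBlocks_kkt_zero (Γ : Matrix ν ν ℝ) (H : Matrix ν μ ℝ) (H' : Matrix μ ν ℝ) (C : Matrix μ μ ℝ) (Yₛ Yₜ Yₛₜ : Matrix ν ν ℝ) :
    hessT (Matrix.fromBlocks Γ H H' C) (kkt Yₛ (0 : Matrix μ ν ℝ)) (kkt Yₜ (0 : Matrix μ ν ℝ)) (kkt Yₛₜ (0 : Matrix μ ν ℝ)) = hessT Γ Yₛ Yₜ Yₛₜ := by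
  unfold hessT
  rw [trace_fromBlocks_mul_kkt_zero, trace_bubble_fromBlocks_kkt_zero]

omit [DecidableEq ν] in
/-- [folklore] `hessT` with a difference of legs: `hessT (G − P) V V′ W = hessT G V V′ W − ½tr(PW) + ½tr(PV·GV′) + ½tr(GV·PV′) − ½tr(PV·PV′)`. -/
theorem hessT_sub_leg (G P V V' W : Matrix ν ν ℝ) : hessT (G - P) V V' W
    = hessT G V V' W - (1 / 2) * (P * W).trace + (1 / 2) * (P * V * (G * V')).trace + (1 / 2) * (G * V * (P * V')).trace
      - (1 / 2) * (P * V * (P * V')).trace := by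
  unfold hessT
  simp only [Matrix.sub_mul, Matrix.mul_sub, Matrix.trace_sub]
  ring

omit [DecidableEq ν] [DecidableEq μ] in
/-- [folklore] THE COARSE-GRAM FUNCTIONAL IN `P`-WORDS: with `P := GQᵀCQG`, `hessT C (−QGYₛGQᵀ) (−QGYₜGQᵀ) (−QGYₛₜGQᵀ + QGYₛGYₜGQᵀ + QGYₜGYₛGQᵀ)
= −½tr(P·Yₛₜ) + ½tr(PYₛ·GYₜ) + ½tr(GYₛ·PYₜ) − ½tr(PYₛ·PYₜ)` (trace cyclicity; no hypothesis). -/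
theorem hessT_coarse_words (G Yₛ Yₜ Yₛₜ : Matrix ν ν ℝ) (Q : Matrix μ ν ℝ) (C : Matrix μ μ ℝ) :
    hessT C (-(Q * G * Yₛ * G * Qᵀ)) (-(Q * G * Yₜ * G * Qᵀ))
        (-(Q * G * Yₛₜ * G * Qᵀ) + Q * G * Yₛ * G * Yₜ * G * Qᵀ + Q * G * Yₜ * G * Yₛ * G * Qᵀ)
      = -((1 / 2) * (G * Qᵀ * C * Q * G * Yₛₜ).trace) + (1 / 2) * (G * Qᵀ * C * Q * G * Yₛ * (G * Yₜ)).trace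
        + (1 / 2) * (G * Yₛ * (G * Qᵀ * C * Q * G * Yₜ)).trace - (1 / 2) * (G * Qᵀ * C * Q * G * Yₛ * (G * Qᵀ * C * Q * G * Yₜ)).trace := by
  -- the four cyclic identities
  have i1 : (C * (Q * G * Yₛₜ * G * Qᵀ)).trace = (G * Qᵀ * C * Q * G * Yₛₜ).trace := by
    rw [show C * (Q * G * Yₛₜ * G * Qᵀ) = (C * Q * G * Yₛₜ) * (G * Qᵀ) by simp only [Matrix.mul_assoc], Matrix.trace_mul_comm]
    simp only [Matrix.mul_assoc]
  have i2 : (C * (Q * G * Yₛ * G * Yₜ * G * Qᵀ)).trace = (G * Qᵀ * C * Q * G * Yₛ * (G * Yₜ)).trace := by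
    rw [show C * (Q * G * Yₛ * G * Yₜ * G * Qᵀ) = (C * Q * G * Yₛ * G * Yₜ) * (G * Qᵀ) by simp only [Matrix.mul_assoc], Matrix.trace_mul_comm]
    simp only [Matrix.mul_assoc]
  have i3 : (C * (Q * G * Yₜ * G * Yₛ * G * Qᵀ)).trace = (G * Yₛ * (G * Qᵀ * C * Q * G * Yₜ)).trace := by
    rw [show C * (Q * G * Yₜ * G * Yₛ * G * Qᵀ) = (C * Q * G * Yₜ) * (G * Yₛ * G * Qᵀ) by simp only [Matrix.mul_assoc], Matrix.trace_mul_comm]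
    simp only [Matrix.mul_assoc]
  have i4 : (C * (Q * G * Yₛ * G * Qᵀ) * (C * (Q * G * Yₜ * G * Qᵀ))).trace
      = (G * Qᵀ * C * Q * G * Yₛ * (G * Qᵀ * C * Q * G * Yₜ)).trace := by
    rw [show C * (Q * G * Yₛ * G * Qᵀ) * (C * (Q * G * Yₜ * G * Qᵀ)) = (C * Q * G * Yₛ * G * Qᵀ * C * Q * G * Yₜ) * (G * Qᵀ) by
      simp only [Matrix.mul_assoc], Matrix.trace_mul_comm]
    simp only [Matrix.mul_assoc]
  unfold hessT
  rw [Matrix.mul_add, Matrix.mul_add, Matrix.mul_neg, Matrix.trace_add, Matrix.trace_add, Matrix.trace_neg, Matrix.mul_neg, Matrix.mul_neg,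
    neg_mul_neg, i1, i2, i3, i4]
  ring

/-- [folklore] **THE BORDERED FUNCTIONAL WITH A CONSTANT BORDER = BULK + COARSE GRAM** (jet form of the Schur factorisation
`det kkt (Y, Q) = ± det Y · det (QY⁻¹Qᵀ)`; NO symmetry of `Y` used): for `IsUnit Y₀.det`, `IsUnit (QY₀⁻¹Qᵀ).det` and ANY jets `Yₛ Yₜ Yₛₜ`,
`hessT ((kkt Y₀ Q)⁻¹; kkt Yₛ 0, kkt Yₜ 0, kkt Yₛₜ 0) = hessT (Y₀⁻¹; Yₛ, Yₜ, Yₛₜ) + hessT (S₀⁻¹; Sₛ, Sₜ, Sₛₜ)` with `S₀ = QY₀⁻¹Qᵀ` and the inverse-jet words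
`Sₛ = −QY₀⁻¹YₛY₀⁻¹Qᵀ`, `Sₜ` likewise, `Sₛₜ = −QY₀⁻¹YₛₜY₀⁻¹Qᵀ + QY₀⁻¹YₛY₀⁻¹YₜY₀⁻¹Qᵀ + QY₀⁻¹YₜY₀⁻¹YₛY₀⁻¹Qᵀ`. -/
theorem hessT_kkt_const_border (Y₀ Yₛ Yₜ Yₛₜ : Matrix ν ν ℝ) (Q : Matrix μ ν ℝ) (hY : IsUnit Y₀.det) (hS : IsUnit (Q * Y₀⁻¹ * Qᵀ).det) :
    hessT (kkt Y₀ Q)⁻¹ (kkt Yₛ (0 : Matrix μ ν ℝ)) (kkt Yₜ (0 : Matrix μ ν ℝ)) (kkt Yₛₜ (0 : Matrix μ ν ℝ))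
      = hessT Y₀⁻¹ Yₛ Yₜ Yₛₜ
        + hessT (Q * Y₀⁻¹ * Qᵀ)⁻¹ (-(Q * Y₀⁻¹ * Yₛ * Y₀⁻¹ * Qᵀ)) (-(Q * Y₀⁻¹ * Yₜ * Y₀⁻¹ * Qᵀ))
            (-(Q * Y₀⁻¹ * Yₛₜ * Y₀⁻¹ * Qᵀ) + Q * Y₀⁻¹ * Yₛ * Y₀⁻¹ * Yₜ * Y₀⁻¹ * Qᵀ + Q * Y₀⁻¹ * Yₜ * Y₀⁻¹ * Yₛ * Y₀⁻¹ * Qᵀ) := by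
  rw [kkt_inv_eq_blocks Y₀ Q hY hS, hessT_fromBlocks_kkt_zero, hessT_sub_leg, hessT_coarse_words]
  ring

end Border

/-! ## §3 The bordered functional of a product: bulk `A` + bulk `B` + coarse Gram -/

section Prod

variable {ν μ : Type*} [Fintype ν] [Fintype μ] [DecidableEq ν] [DecidableEq μ]

/-- [folklore] **«K-TB3a-PROD»: THE BORDERED FUNCTIONAL OF A PRODUCT WITH A CONSTANT BORDER.**  For `A₀`, `B₀` with `det ≠ 0` (`IsUnit`),
`S̃₀ := Q·(A₀B₀)⁻¹·Qᵀ` invertible, and ANY jets `A•`, `B•`, with the product-rule jets `Yₛ = AₛB₀ + A₀Bₛ`, `Yₜ`, `Yₛₜ = AₛₜB₀ + AₛBₜ + AₜBₛ + A₀Bₛₜ`: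
`hessT ((kkt (A₀B₀) Q)⁻¹; kkt Y• 0) = hessT (A₀⁻¹; A•) + hessT (B₀⁻¹; B•) + hessT (S̃₀⁻¹; S̃•)`, the coarse-Gram words `S̃•` being the inverse-jet
words of §2 at `Y = AB`.  The two-factor twin of `GhostSplitJets.hessT_kkt_sq_jets`. -/
theorem hessT_kkt_prod_jets (A₀ Aₛ Aₜ Aₛₜ B₀ Bₛ Bₜ Bₛₜ : Matrix ν ν ℝ) (Q : Matrix μ ν ℝ) (hA : IsUnit A₀.det) (hB : IsUnit B₀.det)
    (hS : IsUnit (Q * (A₀ * B₀)⁻¹ * Qᵀ).det) :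
    hessT (kkt (A₀ * B₀) Q)⁻¹ (kkt (Aₛ * B₀ + A₀ * Bₛ) (0 : Matrix μ ν ℝ)) (kkt (Aₜ * B₀ + A₀ * Bₜ) (0 : Matrix μ ν ℝ))
        (kkt (Aₛₜ * B₀ + Aₛ * Bₜ + Aₜ * Bₛ + A₀ * Bₛₜ) (0 : Matrix μ ν ℝ))
      = hessT A₀⁻¹ Aₛ Aₜ Aₛₜ + hessT B₀⁻¹ Bₛ Bₜ Bₛₜ
        + hessT (Q * (A₀ * B₀)⁻¹ * Qᵀ)⁻¹
            (-(Q * (A₀ * B₀)⁻¹ * (Aₛ * B₀ + A₀ * Bₛ) * (A₀ * B₀)⁻¹ * Qᵀ))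
            (-(Q * (A₀ * B₀)⁻¹ * (Aₜ * B₀ + A₀ * Bₜ) * (A₀ * B₀)⁻¹ * Qᵀ))
            (-(Q * (A₀ * B₀)⁻¹ * (Aₛₜ * B₀ + Aₛ * Bₜ + Aₜ * Bₛ + A₀ * Bₛₜ) * (A₀ * B₀)⁻¹ * Qᵀ)
              + Q * (A₀ * B₀)⁻¹ * (Aₛ * B₀ + A₀ * Bₛ) * (A₀ * B₀)⁻¹ * (Aₜ * B₀ + A₀ * Bₜ) * (A₀ * B₀)⁻¹ * Qᵀ
              + Q * (A₀ * B₀)⁻¹ * (Aₜ * B₀ + A₀ * Bₜ) * (A₀ * B₀)⁻¹ * (Aₛ * B₀ + A₀ * Bₛ) * (A₀ * B₀)⁻¹ * Qᵀ) := by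
  have hY : IsUnit (A₀ * B₀).det := by rw [Matrix.det_mul]; exact hA.mul hB
  rw [hessT_kkt_const_border _ _ _ _ Q hY hS, hessT_mul_jets _ _ _ _ _ _ _ _ hA hB]

end Prod

end Summit.QuantumFields.BalabanUV.Beta.D1BFx.GhostSplitJetsProd

end
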